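import Mathlib
import Summits.ValiantsHypothesis.ValiantsHypothesis.Theses.LiouvilleSarnak
import Summits.ValiantsHypothesis.ValiantsHypothesis.Theorems.LiouvilleSarnakLiouvilleCutRankFourStubGoodWindow
import Summits.ValiantsHypothesis.ValiantsHypothesis.Theorems.LiouvilleSarnakLiouvilleCutRankFourStubWindowRank

/-!
# Crux `LiouvilleSarnak.LiouvilleCutRankFour` (stmt-ValiantsHypothesis-21039) — line `window_certificate`

Skeleton line (crux-plan, planner `val-width-lines-2`, 2026-08-27; reshaped by the lead prover
`val-width-21039-p1` g2: the two stub statements are now DEFINITION-FREE — the former local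
abbreviations `windowCode π s hs` and `goodCodes` are written out — so that def-free `Theorems/`
files can carry the registered signatures verbatim; the statements are definitionally the planner's).
**LINE CLOSED (2026-08-28): both stubs LANDED** — `stub_goodWindow` = p587755
`Theorems/LiouvilleSarnakLiouvilleCutRankFourStubGoodWindow.lean`, `stub_windowRank` = p587753
`Theorems/LiouvilleSarnakLiouvilleCutRankFourStubWindowRank.lean` (namespace
`…Theorems.LiouvilleSarnakCutRankFour.WindowCertificate`); this skeleton is now `sorry`-free and
`LiouvilleCutRankFour_of` is a second kernel-checked proof of the crux along the line.
The crux: for all large `n` and EVERY balanced cut `π` of the `2n` bit positions into `n` row bits and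
`n` column bits, the `2^n × 2^n` matrix `M_π(r, c) = λ(N_π(r,c) + 1)` (`λ` = Liouville, `N_π(r,c)` the
number whose bits are read off `r`/`c` through `π`) has rank `≥ 4`.  The crux itself is PROVED
(`Theorems/LiouvilleSarnakCutRankFour.lean`, val-width-21039-p1 g0, 2026-08-27, `n₀ = 3`); this line cuts
the same argument into its two lemmas:

* `stub_goodWindow` (combinatorics of words, S): every balanced cut with `n ≥ 3` has five consecutive
  positions `s, …, s+4` whose row/column word is GOOD — one of the 18 words with two or three row letters
  other than `RCCRC`, `CRRCR`; as a code (bit `k` set iff position `s+k` is a row bit): one of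
  `{3, 5, 6, 7, 10, 11, 12, 13, 14, 17, 18, 19, 20, 21, 24, 25, 26, 28}`.  True for all `n ≥ 3`: if no
  window is good, a six-letter step fact forces every window from position `1` on to have `≤ 1` or
  `≥ 4` row letters, the two regimes do not mix (counts move by `≤ 1`), and a sharp block count gives
  `< n` letters of one kind.
* `stub_windowRank` (embedding + certificates, M): at a good window, set every bit BELOW the window to
  `1` and every bit ABOVE it to `0`; then `N + 1 = 2^s (K + 1)` with `K < 32` read off the window, so by
  complete multiplicativity (`Theorems.LiouvilleSarnakAligned.liouville_two_pow_mul`: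
  `λ(2^s x) = (-1)^s λ(x)`) a `4 × 4` submatrix is `± (λ(K(r,c) + 1))`, an explicit sign matrix on
  `λ|[1,32]` of determinant `±8` (`decide`), and `Matrix.rank_submatrix_le` gives rank `≥ 4`.
* `LiouvilleCutRankFour_of`: composition (kernel-checked, trivial).
-/

set_option linter.dupNamespace false

namespace Summit.ValiantsHypothesis.ValiantsHypothesis.Cruxes.LiouvilleCutRankFour.WindowCertificate

open Summit.ValiantsHypothesis.ValiantsHypothesis.Theses.LiouvilleSarnak

/-- Codes of the 18 GOOD five-letter row/column words (bit `k` of the code is set iff window position `s + k`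
is a ROW bit): all words with two or three row letters except `RCCRC` (code 9) and `CRRCR` (code 22).
(Documentation of the encoding; the stubs below spell this set out literally.) -/
def goodCodes : Finset ℕ := {3, 5, 6, 7, 10, 11, 12, 13, 14, 17, 18, 19, 20, 21, 24, 25, 26, 28}

/-- The row/column word of the window `s, …, s+4` of a cut `π`, as a code `< 32`.
(Documentation of the encoding; the stubs below spell this term out literally.) -/
def windowCode {n : ℕ} (π : Fin n ⊕ Fin n ≃ Fin (2 * n)) (s : ℕ) (hs : s + 5 ≤ 2 * n) : ℕ :=
  Nat.ofBits fun k : Fin 5 => (π.symm ⟨s + k, by omega⟩).isLeft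

/-- **Stub 1 (LANDED p587755) — a good window exists.**  For `n ≥ 3`, every balanced cut has five
consecutive bit positions whose row/column word is good (statement = `windowCode π s hs ∈ goodCodes`,
written out). [folklore] -/
theorem stub_goodWindow :
    ∀ n : ℕ, 3 ≤ n → ∀ π : Fin n ⊕ Fin n ≃ Fin (2 * n),
      ∃ (s : ℕ) (hs : s + 5 ≤ 2 * n),
        (Nat.ofBits fun k : Fin 5 => (π.symm ⟨s + k, by omega⟩).isLeft) ∈
          ({3, 5, 6, 7, 10, 11, 12, 13, 14, 17, 18, 19, 20, 21, 24, 25, 26, 28} : Finset ℕ) :=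
  Summit.ValiantsHypothesis.ValiantsHypothesis.Theorems.LiouvilleSarnakCutRankFour.WindowCertificate.stub_goodWindow

/-- **Stub 2 (LANDED p587753) — a good window carries a nonsingular `4 × 4` minor.**  Bits below the
window are set to `1`, above to `0`; two row and two column positions inside the window vary;
`N + 1 = 2^s (K + 1)`, `λ(2^s x) = (-1)^s λ(x)` (`liouville_two_pow_mul`), and the resulting sign matrix
`(λ(K(r,c)+1))_{r,c}` on `λ|[1,32]` has determinant `±8` (hypothesis = `windowCode π s hs ∈ goodCodes`,
written out). [cite: Coons2011, Theorem 1.5] -/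
theorem stub_windowRank :
    ∀ n : ℕ, 3 ≤ n → ∀ π : Fin n ⊕ Fin n ≃ Fin (2 * n), ∀ (s : ℕ) (hs : s + 5 ≤ 2 * n),
      (Nat.ofBits fun k : Fin 5 => (π.symm ⟨s + k, by omega⟩).isLeft) ∈
        ({3, 5, 6, 7, 10, 11, 12, 13, 14, 17, 18, 19, 20, 21, 24, 25, 26, 28} : Finset ℕ) →
      4 ≤ (Matrix.of fun r c : Fin n → Bool =>
        (((ArithmeticFunction.liouville
          (Nat.ofBits (fun j : Fin (2 * n) => Sum.elim r c (π.symm j)) + 1) : ℤ) : ℂ))).rank :=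
  Summit.ValiantsHypothesis.ValiantsHypothesis.Theorems.LiouvilleSarnakCutRankFour.WindowCertificate.stub_windowRank

/-- **Composition (kernel-checked).** [folklore] -/
theorem LiouvilleCutRankFour_of : LiouvilleCutRankFour := by
  refine ⟨3, fun n hn π => ?_⟩
  obtain ⟨s, hs, hgood⟩ := stub_goodWindow n hn π
  exact stub_windowRank n hn π s hs hgood

end Summit.ValiantsHypothesis.ValiantsHypothesis.Cruxes.LiouvilleCutRankFour.WindowCertificate
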